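import Summits.ABC.IUTFork.Cor312HullGluedStable
import Summits.ABC.IUTFork.Cor312PilotIdelesCapstone
import HarnessLib

/-!
# [IUTchIII] Cor. 3.12 — the hull-glued setting AT THE SETTING OF RECORD: one-set stability of `^{n,∘}𝒰` and local
# invariance at every GOOD packet of `Real.settingDHVol` / `Real.settingDHVolSharp`, and at all but finitely many

PROOF-ONLY instance piece (abc-iut cell, seat abc-iut-w5-d060, WAVE-5) of p424693 `Cor312HullGluedStable` at
abc-iut-c312-5's assembled Dupuy–Hilado-level real setting `Real.settingDHVol` (= abc-iut-c312-7's
`Setting.ofComparison` over `Real.situationDHVol`) and abc-iut-c312-3's sharp-idele specialisation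
`Real.settingDHVolSharp`. TAKES NO SIDE on [IUTchIII] Cor. 3.12; no definition, no `Prop` fact; every ingredient is a
landed theorem of c312-5 g3 (`thetaHull_settingDHVol_eq_of_good`, `thetaLocal_settingDHVol_eq_zero`,
`family_image_latticePk`, `hullDefined_settingDHVol_inr`, `factorMapDH_inr_surjective`), c312-7
(`image_eq_of_mem_indGroup`), c312-3 g4 (`thetaBoxDH_sharp_eq_hullSet_one`, `finite_ne_unitBox_sharp`) or p424693.

* §0 `frameHyps_settingDHVol` (the field-factor comparison is onto at EVERY place, abc-iut-c312-6): at the frames of `settingDHVol` hull-sets admit hulls (`hHas`) and non-degeneracy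
  descends from the hull (`hdeg`) — the two frame hypotheses of p418697, DISCHARGED at the setting of record.
* §1 GOOD packets `(i+1, p)` — `p > 2`, `p ∤ disc(F)`, and the union of the Θ-boxes there is the unit polydisc `𝒪_L`:
  **`stable_thetaHull_settingDHVol_of_good`** — `^{n,∘}𝒰_{i+1,p} = e⁻¹(Π_{v⃗} I_{v⃗})` (c312-5 g3) is STABLE under the
  whole indeterminacy group `indGroup` (generator stability `family_image_latticePk` + closure induction): the
  hypothesis `hst` of p424693 HOLDS there; **`hullGlued_thetaLocal_settingDHVol_of_good`** — so the hull-glued `P♮`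
  has `HullDefined` and the SAME local Θ-volume (`= 0`) at that packet.
* §2 at `Real.settingDHVolSharp` (pilot regions read off Θ- and `q`-ideles): `stable_thetaHull_settingDHVolSharp_of_good` /
  `hullGlued_thetaLocal_settingDHVolSharp_of_good` at every odd `p ∤ disc(F)` where the Θ-ideles are units, and
  **`finite_hullGlued_thetaLocal_ne_settingDHVolSharp`** — the packets `(i+1, p)` at which the hull-gluing CHANGES
  the local Θ-volume form a FINITE set of primes (inside `{p ∣ 2·disc(F)} ∪ {p under S}`).

Reading (neutral): at the setting ADJUDICATION-SPEC §1 names, trading the (Ind3)-family of Kummer images for print's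
hull `^{n,∘}𝒰` is harmless at all but finitely many packets BY THEOREM; at the finitely many remaining packets the
DH reading of (Ind2) (all lattice automorphisms, p425317 `Cor312HullShearWitness`) leaves `hst` open, so no global
`Statement ↔` is claimed here. Nothing constrains the Θ-glue or the disputed inequality.
[claim: Mochizuki2012, status: disputed] vocabulary only. [cite: DupuyHilado2025, §3.9, §4.7, §4.9]
-/

noncomputable section

open Set Function

namespace Summit.ABC

namespace IUTFork

namespace Thm311

namespace Real

open Cor312 Cor312.Setting Cor312Vol Literature.IUT.LogThetaLattice Literature.IUT.LogVolume

variable {F : Type} [Field F] [NumberField F] (X : PilotData F) {logv : PadicLogs F} (hlog : LogvAnalytic logv)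

/-! ## 0. The field-factor comparison is onto at every place; the frame hypotheses at `settingDHVol` -/

/-- The field-factor comparison `factorMapDH` is ONTO at every place (at a prime: c312-5's
`factorMapDH_inr_surjective`; at `∞` the factor index is empty) — a private copy of abc-iut-c312-6's
`Real.factorMapDH_surjective` (`Cor312FrameVolumePiecesDH`, p424654) to keep this file's imports minimal. [folklore] -/
private theorem factorMapDH_surjective_aux (j : (thetaIndex X).Label) (vQ : (thetaIndex X).VQ) :
    Function.Surjective (factorMapDH X hlog j vQ) := by
  cases vQ with
  | inl u =>
    haveI := isEmpty_factorIdxDH_inl X hlog u j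
    exact fun y => ⟨0, Subsingleton.elim _ _⟩
  | inr pp => exact factorMapDH_inr_surjective X hlog j pp

section Setting

variable (M : Type) [Field M] [NumberField M]
  (archPk : ∀ (j : (thetaIndex X).Label) (vQ : (thetaIndex X).VQ), Set ((logShellsDH X logv).Packet j vQ))
  (archSub : ∀ (j : (thetaIndex X).Label) (v : (thetaIndex X).V),
    Set ((logShellsDH X logv).Packet j ((thetaIndex X).over v)))
  (Ψ : ℤ → ∀ v : (thetaIndex X).V, v ∈ (thetaIndex X).Vbad → Set ((logShellsDH X logv).StarPacket v))
  (act : ℤ → ∀ v : (thetaIndex X).V, v ∈ (thetaIndex X).Vbad →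
    (logShellsDH X logv).StarPacket v → Module.End ℚ ((logShellsDH X logv).StarPacket v))
  (Mmod : ℤ → ∀ j : (thetaIndex X).LabelStar, Set ((logShellsDH X logv).GlobalPacket j.1))
  (region : ℤ → ∀ j : (thetaIndex X).LabelStar, FinDivisor M → ∀ vQ : (thetaIndex X).VQ,
    Set ((logShellsDH X logv).Packet j.1 vQ))
  (n : ℤ) {HT : Type} {LogLink : HT → HT → Type} {IsFull : ∀ {s t : HT}, LogLink s t → Prop}
  (lat : LGPGaussianLogThetaLattice LogLink IsFull)
  {Frd : Type} {IsoF : Frd → Frd → Type} {Ob : Frd → Type} {realify : Frd → Frd} {Strip : Type}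
  {IsoS : Strip → Strip → Type} {Mv : ∀ v : (thetaIndex X).V, v ∈ (thetaIndex X).Vbad → Type}
  [∀ v h, Monoid (Mv v h)]
  (sig : GlobalLGPFrobenioidSignature (thetaIndex X).lstar (thetaIndex X).V (· ∈ (thetaIndex X).Vbad)
    Frd IsoF Ob realify Strip IsoS Mv)
  (split : SplittingMonoids Mv) {ObΔ : Type} {N : ∀ v : (thetaIndex X).V, v ∈ (thetaIndex X).Vbad → Type}
  [∀ v h, Monoid (N v h)] (qData : QPilotData ObΔ N)
  (thetaBox : ℤ → Ob sig.Clgp → ∀ (j : (thetaIndex X).Label) (vQ : (thetaIndex X).VQ),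
    Set (∀ s : factorIdxDH X hlog j vQ, factorFieldDH X hlog j vQ s))
  (qCentre : ObΔ → ∀ (j : (thetaIndex X).Label) (vQ : (thetaIndex X).VQ),
    ∀ s : factorIdxDH X hlog j vQ, factorFieldDH X hlog j vQ s)
  (hq : ∀ j vQ s, qCentre (qPilotObject qData) j vQ s ≠ 0)
  (hfin : ∀ j : (thetaIndex X).Label, (Function.support fun vQ =>
    ((situationDHVol X hlog M archPk archSub Ψ act Mmod region).D n).logvol j vQ
      (factorMapDH X hlog j vQ ⁻¹' hullSet (factorFieldDH X hlog j vQ) (qCentre (qPilotObject qData) j vQ))).Finite)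

/-- **The two frame hypotheses of p418697 HOLD at the frames of `settingDHVol`** (every label packet): hull-sets
admit hulls (`hHas`) and non-degeneracy descends from the hull (`hdeg`) — p424693 `frameHyps_ofComparison_of_surjective`
with `factorMapDH_surjective`. [claim: Mochizuki2012, status: disputed] -/
theorem frameHyps_settingDHVol (i : Fin (thetaIndex X).lstar) (vQ : (thetaIndex X).VQ) :
    (∀ H ∈ ((settingDHVol X hlog M archPk archSub Ψ act Mmod region n lat sig split qData thetaBox qCentre hq
        hfin).frame (Setting.labelSucc i) vQ).Hul,
      ((settingDHVol X hlog M archPk archSub Ψ act Mmod region n lat sig split qData thetaBox qCentre hq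
        hfin).frame (Setting.labelSucc i) vQ).HasHull H) ∧
    (∀ U : Set ((logShellsDH X logv).Packet (Setting.labelSucc i) vQ),
      ((settingDHVol X hlog M archPk archSub Ψ act Mmod region n lat sig split qData thetaBox qCentre hq
          hfin).frame (Setting.labelSucc i) vQ).IsBounded U →
      ((settingDHVol X hlog M archPk archSub Ψ act Mmod region n lat sig split qData thetaBox qCentre hq
          hfin).frame (Setting.labelSucc i) vQ).HasHull
        (((settingDHVol X hlog M archPk archSub Ψ act Mmod region n lat sig split qData thetaBox qCentre hq
          hfin).frame (Setting.labelSucc i) vQ).hull U) →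
      ((settingDHVol X hlog M archPk archSub Ψ act Mmod region n lat sig split qData thetaBox qCentre hq
          hfin).frame (Setting.labelSucc i) vQ).HasHull U) :=
  Setting.frameHyps_ofComparison_of_surjective n lat sig split qData _ hq _ hfin
    (fun i vQ => factorMapDH_surjective_aux X hlog (Setting.labelSucc i) vQ) i vQ

/-! ## 1. GOOD packets of `settingDHVol`: `^{n,∘}𝒰` is (Ind1),(Ind2)-stable; the hull-gluing changes nothing there -/

/-- **At a GOOD packet, print's `^{n,∘}𝒰_{i+1,p}` is STABLE under the whole indeterminacy group** — the hypothesis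
`hst` of p424693 at the setting of record: for `p > 2`, `p ∤ disc(F)` and Θ-boxes with union `𝒪_L` at `(i+1, p)`,
`^{n,∘}𝒰_{i+1,p} = e⁻¹(Π_{v⃗} I_{v⃗})` (abc-iut-c312-5 `thetaHull_settingDHVol_eq_of_good`), which every (Ind1)/(Ind2)
family maps onto itself (`family_image_latticePk`, Dupuy–Hilado §4.7/§4.9), hence every element of `indGroup`
(abc-iut-c312-7 `image_eq_of_mem_indGroup`). [cite: DupuyHilado2025, §4.7, §4.9] -/
theorem stable_thetaHull_settingDHVol_of_good (i : Fin (thetaIndex X).lstar) (pp : Nat.Primes)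
    (hp2 : 2 < (pp : ℕ)) (hdisc : ¬ ((pp : ℕ) : ℤ) ∣ NumberField.discr F)
    (hbox : (⋃ m : ℤ, thetaBox m (thetaPilotObject sig split) (Setting.labelSucc i) (.inr pp)) =
      hullSet (factorFieldDH X hlog (Setting.labelSucc i) (.inr pp)) (fun _ => 1)) :
    ∀ Φ ∈ indGroup (situationDHVol X hlog M archPk archSub Ψ act Mmod region),
      Φ (Setting.labelSucc i) (.inr pp) ''
          (settingDHVol X hlog M archPk archSub Ψ act Mmod region n lat sig split qData thetaBox qCentre hq
            hfin).thetaHull (Setting.labelSucc i) (.inr pp) =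
        (settingDHVol X hlog M archPk archSub Ψ act Mmod region n lat sig split qData thetaBox qCentre hq
          hfin).thetaHull (Setting.labelSucc i) (.inr pp) := by
  haveI : Fact (pp : ℕ).Prime := ⟨pp.2⟩
  intro Φ hΦ
  rw [thetaHull_settingDHVol_eq_of_good X hlog M archPk archSub Ψ act Mmod region n lat sig split qData thetaBox
    qCentre hq hfin i pp hp2 hdisc hbox]
  exact image_eq_of_mem_indGroup _ (fun Ψ' hΨ' => (presAt X hlog pp).family_image_latticePk hΨ' _ 1) hΦ

/-- **At a GOOD packet the hull-gluing changes nothing**: the hull-glued setting `P♮` (print's `^{n,∘}𝒰` as THE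
Θ-region at every packet, p418697) has `HullDefined` at `(i+1, p)` and the SAME local Θ-volume there, namely `0`
(abc-iut-c312-5 `thetaLocal_settingDHVol_eq_zero`; p424693 `hullGlued_hullDefined_thetaLocal_of_stable` with §0/§1).
[claim: Mochizuki2012, status: disputed] -/
theorem hullGlued_thetaLocal_settingDHVol_of_good (i : Fin (thetaIndex X).lstar) (pp : Nat.Primes)
    (hp2 : 2 < (pp : ℕ)) (hdisc : ¬ ((pp : ℕ) : ℤ) ∣ NumberField.discr F)
    (hbox : (⋃ m : ℤ, thetaBox m (thetaPilotObject sig split) (Setting.labelSucc i) (.inr pp)) =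
      hullSet (factorFieldDH X hlog (Setting.labelSucc i) (.inr pp)) (fun _ => 1)) :
    (settingDHVol X hlog M archPk archSub Ψ act Mmod region n lat sig split qData thetaBox qCentre hq
        hfin).hullGlued.HullDefined (Setting.labelSucc i) (.inr pp) ∧
      (settingDHVol X hlog M archPk archSub Ψ act Mmod region n lat sig split qData thetaBox qCentre hq
          hfin).hullGlued.thetaLocal (Setting.labelSucc i) (.inr pp) =
        (settingDHVol X hlog M archPk archSub Ψ act Mmod region n lat sig split qData thetaBox qCentre hq
          hfin).thetaLocal (Setting.labelSucc i) (.inr pp) ∧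
      (settingDHVol X hlog M archPk archSub Ψ act Mmod region n lat sig split qData thetaBox qCentre hq
          hfin).hullGlued.thetaLocal (Setting.labelSucc i) (.inr pp) = ((0 : ℝ) : WithTop ℝ) := by
  haveI : Fact (pp : ℕ).Prime := ⟨pp.2⟩
  have hHul : IsHullSet (factorFieldDH X hlog (Setting.labelSucc i) (.inr pp))
      (hullSet (factorFieldDH X hlog (Setting.labelSucc i) (.inr pp)) (fun _ => 1)) :=
    ⟨fun _ => 1, fun _ => one_ne_zero, rfl⟩
  have hdef : (settingDHVol X hlog M archPk archSub Ψ act Mmod region n lat sig split qData thetaBox qCentre hq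
      hfin).HullDefined (Setting.labelSucc i) (.inr pp) :=
    hullDefined_settingDHVol_inr X hlog M archPk archSub Ψ act Mmod region n lat sig split qData thetaBox qCentre hq
      hfin _ pp (by rw [hbox]; exact isBounded_hullSet _ _) (by rw [hbox]; exact hHul.isNondegenerate)
  have h := (settingDHVol X hlog M archPk archSub Ψ act Mmod region n lat sig split qData thetaBox qCentre hq
      hfin).hullGlued_hullDefined_thetaLocal_of_stable
    (stable_thetaHull_settingDHVol_of_good X hlog M archPk archSub Ψ act Mmod region n lat sig split qData thetaBox
      qCentre hq hfin i pp hp2 hdisc hbox)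
    (frameHyps_settingDHVol X hlog M archPk archSub Ψ act Mmod region n lat sig split qData thetaBox qCentre hq hfin
      i (.inr pp)).1 hdef
  exact ⟨h.1, h.2, h.2.trans (thetaLocal_settingDHVol_eq_zero X hlog M archPk archSub Ψ act Mmod region n lat sig
    split qData thetaBox qCentre hq hfin i pp hp2 hdisc hbox)⟩

/-- **The hull-gluing changes the local Θ-volume at only FINITELY MANY packets** `(i+1, p)`: wherever the Θ-boxes
have union `𝒪_L` off a finite prime set (the third box condition of abc-iut-c312-5's `thetaFinite_settingDHVol`),
the exceptional primes lie inside that set together with the primes dividing `2·disc(F)`. [claim: Mochizuki2012, status: disputed] -/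
theorem finite_hullGlued_thetaLocal_ne_settingDHVol (i : Fin (thetaIndex X).lstar)
    (hcof : {pp : Nat.Primes |
      (⋃ m : ℤ, thetaBox m (thetaPilotObject sig split) (Setting.labelSucc i) (.inr pp)) ≠
        hullSet (factorFieldDH X hlog (Setting.labelSucc i) (.inr pp)) (fun _ => 1)}.Finite) :
    {pp : Nat.Primes |
      (settingDHVol X hlog M archPk archSub Ψ act Mmod region n lat sig split qData thetaBox qCentre hq
          hfin).hullGlued.thetaLocal (Setting.labelSucc i) (.inr pp) ≠
        (settingDHVol X hlog M archPk archSub Ψ act Mmod region n lat sig split qData thetaBox qCentre hq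
          hfin).thetaLocal (Setting.labelSucc i) (.inr pp)}.Finite := by
  have hD : 2 * (NumberField.discr F).natAbs ≠ 0 :=
    mul_ne_zero two_ne_zero (Int.natAbs_ne_zero.2 (NumberField.discr_ne_zero F))
  refine ((finite_primes_dvd hD).union hcof).subset fun pp hpp => ?_
  by_contra hgood
  rw [Set.mem_union, not_or] at hgood
  obtain ⟨hp2, hdisc⟩ := good_of_not_dvd (F := F) pp hgood.1
  have hbox : (⋃ m : ℤ, thetaBox m (thetaPilotObject sig split) (Setting.labelSucc i) (.inr pp)) =
      hullSet (factorFieldDH X hlog (Setting.labelSucc i) (.inr pp)) (fun _ => 1) := by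
    by_contra h
    exact hgood.2 h
  exact hpp (hullGlued_thetaLocal_settingDHVol_of_good X hlog M archPk archSub Ψ act Mmod region n lat sig split
    qData thetaBox qCentre hq hfin i pp hp2 hdisc hbox).2.1

end Setting

/-! ## 2. At `Real.settingDHVolSharp` (pilot regions read off ideles) -/

section Sharp

variable (t : ∀ (pp : Nat.Primes) (_ : Fin X.lstar) (x : (thetaIndex X).Fibre (.inr pp)),
    haveI : Fact (pp : ℕ).Prime := ⟨pp.2⟩; kOf X pp.1 x)
  (tq : ∀ (pp : Nat.Primes) (x : (thetaIndex X).Fibre (.inr pp)),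
    haveI : Fact (pp : ℕ).Prime := ⟨pp.2⟩; kOf X pp.1 x)
  (M : Type) [Field M] [NumberField M]
  (archPk : ∀ (j : (thetaIndex X).Label) (vQ : (thetaIndex X).VQ), Set ((logShellsDH X logv).Packet j vQ))
  (archSub : ∀ (j : (thetaIndex X).Label) (v : (thetaIndex X).V),
    Set ((logShellsDH X logv).Packet j ((thetaIndex X).over v)))
  (Ψ : ℤ → ∀ v : (thetaIndex X).V, v ∈ (thetaIndex X).Vbad → Set ((logShellsDH X logv).StarPacket v))
  (act : ℤ → ∀ v : (thetaIndex X).V, v ∈ (thetaIndex X).Vbad →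
    (logShellsDH X logv).StarPacket v → Module.End ℚ ((logShellsDH X logv).StarPacket v))
  (Mmod : ℤ → ∀ j : (thetaIndex X).LabelStar, Set ((logShellsDH X logv).GlobalPacket j.1))
  (region : ℤ → ∀ j : (thetaIndex X).LabelStar, FinDivisor M → ∀ vQ : (thetaIndex X).VQ,
    Set ((logShellsDH X logv).Packet j.1 vQ))
  (n : ℤ) {HT : Type} {LogLink : HT → HT → Type} {IsFull : ∀ {s t : HT}, LogLink s t → Prop}
  (lat : LGPGaussianLogThetaLattice LogLink IsFull)
  {Frd : Type} {IsoF : Frd → Frd → Type} {Ob : Frd → Type} {realify : Frd → Frd} {Strip : Type}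
  {IsoS : Strip → Strip → Type} {Mv : ∀ v : (thetaIndex X).V, v ∈ (thetaIndex X).Vbad → Type}
  [∀ v h, Monoid (Mv v h)]
  (sig : GlobalLGPFrobenioidSignature (thetaIndex X).lstar (thetaIndex X).V (· ∈ (thetaIndex X).Vbad)
    Frd IsoF Ob realify Strip IsoS Mv)
  (split : SplittingMonoids Mv) {ObΔ : Type} {N : ∀ v : (thetaIndex X).V, v ∈ (thetaIndex X).Vbad → Type}
  [∀ v h, Monoid (N v h)] (qData : QPilotData ObΔ N)

/-- **At the sharp setting of record, `^{n,∘}𝒰_{i+1,p}` is (Ind1),(Ind2)-STABLE at every odd `p ∤ disc(F)` where the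
Θ-ideles are units** (there the sharp box IS `𝒪_L`, abc-iut-c312-3 `thetaBoxDH_sharp_eq_hullSet_one`).
[cite: DupuyHilado2025, §3.9, §4.7, §4.9] -/
theorem stable_thetaHull_settingDHVolSharp_of_good (ht0 : ∀ pp i x, t pp i x ≠ 0) (htq0 : ∀ pp x, tq pp x ≠ 0)
    (htq1 : ∀ (pp : Nat.Primes) (x : (thetaIndex X).Fibre (.inr pp)),
      haveI : Fact (pp : ℕ).Prime := ⟨pp.2⟩; placeOf X pp.1 x ∉ X.S → ‖tq pp x‖ = 1)
    (i : Fin (thetaIndex X).lstar) (pp : Nat.Primes) (hp2 : 2 < (pp : ℕ))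
    (hdisc : ¬ ((pp : ℕ) : ℤ) ∣ NumberField.discr F)
    (h1 : ∀ x : (thetaIndex X).Fibre (.inr pp), haveI : Fact (pp : ℕ).Prime := ⟨pp.2⟩; ‖t pp i x‖ = 1) :
    ∀ Φ ∈ indGroup (situationDHVol X hlog M archPk archSub Ψ act Mmod region),
      Φ (Setting.labelSucc i) (.inr pp) ''
          (settingDHVolSharp X hlog M archPk archSub Ψ act Mmod region n lat sig split qData tq t htq0
            htq1).thetaHull (Setting.labelSucc i) (.inr pp) =
        (settingDHVolSharp X hlog M archPk archSub Ψ act Mmod region n lat sig split qData tq t htq0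
          htq1).thetaHull (Setting.labelSucc i) (.inr pp) :=
  stable_thetaHull_settingDHVol_of_good X hlog M archPk archSub Ψ act Mmod region n lat sig split qData _ _ _ _ i pp
    hp2 hdisc (by rw [iUnion_thetaBoxDH_sharp]; exact thetaBoxDH_sharp_eq_hullSet_one X hlog t ht0 i pp h1)

/-- **At the sharp setting of record the hull-gluing changes nothing at such a packet**: `HullDefined` and the SAME
local Θ-volume (`= 0`) for the hull-glued `P♮`. [claim: Mochizuki2012, status: disputed] -/
theorem hullGlued_thetaLocal_settingDHVolSharp_of_good (ht0 : ∀ pp i x, t pp i x ≠ 0) (htq0 : ∀ pp x, tq pp x ≠ 0)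
    (htq1 : ∀ (pp : Nat.Primes) (x : (thetaIndex X).Fibre (.inr pp)),
      haveI : Fact (pp : ℕ).Prime := ⟨pp.2⟩; placeOf X pp.1 x ∉ X.S → ‖tq pp x‖ = 1)
    (i : Fin (thetaIndex X).lstar) (pp : Nat.Primes) (hp2 : 2 < (pp : ℕ))
    (hdisc : ¬ ((pp : ℕ) : ℤ) ∣ NumberField.discr F)
    (h1 : ∀ x : (thetaIndex X).Fibre (.inr pp), haveI : Fact (pp : ℕ).Prime := ⟨pp.2⟩; ‖t pp i x‖ = 1) :
    (settingDHVolSharp X hlog M archPk archSub Ψ act Mmod region n lat sig split qData tq t htq0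
        htq1).hullGlued.HullDefined (Setting.labelSucc i) (.inr pp) ∧
      (settingDHVolSharp X hlog M archPk archSub Ψ act Mmod region n lat sig split qData tq t htq0
          htq1).hullGlued.thetaLocal (Setting.labelSucc i) (.inr pp) =
        (settingDHVolSharp X hlog M archPk archSub Ψ act Mmod region n lat sig split qData tq t htq0
          htq1).thetaLocal (Setting.labelSucc i) (.inr pp) ∧
      (settingDHVolSharp X hlog M archPk archSub Ψ act Mmod region n lat sig split qData tq t htq0
          htq1).hullGlued.thetaLocal (Setting.labelSucc i) (.inr pp) = ((0 : ℝ) : WithTop ℝ) :=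
  hullGlued_thetaLocal_settingDHVol_of_good X hlog M archPk archSub Ψ act Mmod region n lat sig split qData _ _ _ _ i
    pp hp2 hdisc (by rw [iUnion_thetaBoxDH_sharp]; exact thetaBoxDH_sharp_eq_hullSet_one X hlog t ht0 i pp h1)

/-- **At the sharp setting of record, the hull-gluing changes the local Θ-volume at only FINITELY MANY packets**
`(i+1, p)` (Θ-ideles non-zero and units off `S`): the exceptional primes lie under `S` or divide `2·disc(F)`
(abc-iut-c312-3 `finite_ne_unitBox_sharp`). [claim: Mochizuki2012, status: disputed] -/
theorem finite_hullGlued_thetaLocal_ne_settingDHVolSharp (ht0 : ∀ pp i x, t pp i x ≠ 0)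
    (ht1 : ∀ (pp : Nat.Primes) (i : Fin X.lstar) (x : (thetaIndex X).Fibre (.inr pp)),
      haveI : Fact (pp : ℕ).Prime := ⟨pp.2⟩; placeOf X pp.1 x ∉ X.S → ‖t pp i x‖ = 1)
    (htq0 : ∀ pp x, tq pp x ≠ 0)
    (htq1 : ∀ (pp : Nat.Primes) (x : (thetaIndex X).Fibre (.inr pp)),
      haveI : Fact (pp : ℕ).Prime := ⟨pp.2⟩; placeOf X pp.1 x ∉ X.S → ‖tq pp x‖ = 1)
    (i : Fin (thetaIndex X).lstar) :
    {pp : Nat.Primes |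
      (settingDHVolSharp X hlog M archPk archSub Ψ act Mmod region n lat sig split qData tq t htq0
          htq1).hullGlued.thetaLocal (Setting.labelSucc i) (.inr pp) ≠
        (settingDHVolSharp X hlog M archPk archSub Ψ act Mmod region n lat sig split qData tq t htq0
          htq1).thetaLocal (Setting.labelSucc i) (.inr pp)}.Finite :=
  finite_hullGlued_thetaLocal_ne_settingDHVol X hlog M archPk archSub Ψ act Mmod region n lat sig split qData _ _ _ _ i
    ((finite_ne_unitBox_sharp X hlog t ht0 ht1 i).subset fun pp hpp => by
      rwa [Set.mem_setOf_eq, iUnion_thetaBoxDH_sharp] at hpp)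

end Sharp

end Real

end Thm311

end IUTFork

end Summit.ABC

end
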